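import Summits.QuantumAdvantage.QuantumAdvantage.Theorems.CutDialA
import HarnessLib

/-!
# CutDial (B) — decomp-qadv lens-2, generation 31, part 2/3: the even-`n` magic square and the all-`n` cut-local law

Part A proved the abstract magic square `magic_of_square` and instantiated it for odd `n ≥ 7`.  This part instantiates it for
EVEN `n ≥ 7` (`xE / vE / sgE`, five signed cells) and concludes ★★ `cutLocal_loses`: for every `n ≥ 7`, every rotation `m` and
every bipartition `S` facing `3|3` in the frame rotated by `m`, every `S`-bipartite-local strategy map loses the ring game on an
odd-class input (degree-free); corollaries: arc cuts (`arcLocal_loses`), partition-local maps (`blockLocal_loses`) and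
point-local maps (`pointLocal_loses`, every `n ≥ 7`, odd or even).
-/

set_option linter.dupNamespace false
set_option linter.style.longLine false
set_option linter.unusedSimpArgs false
set_option linter.unusedTactic false
set_option linter.unreachableTactic false
set_option linter.unnecessarySeqFocus false

namespace Summit.QuantumAdvantage.QuantumAdvantage.Theorems.CutDial
open Finset
open Literature.Computability.QuantumComplexity Literature.Computability.QuantumComplexity.RingHLF
open Summit.QuantumAdvantage.AdviceFreeQNC0 (OddZeros rot)
open Summit.QuantumAdvantage.AdviceFreeQNC0.LightConeWindowHard (prv_val nxt_val)
open Summit.QuantumAdvantage.QuantumAdvantage.Theorems.CertDial (dz dot2_eq_signBit_iff xor_xor_and_eq_false_iff)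
open Summit.QuantumAdvantage.QuantumAdvantage.Theorems.RingMinor (oddZeros_rot)
open Summit.QuantumAdvantage.AdviceFreeQNC0.RingSymmetry (shift rot_apply inKernel_rot edgesIn_rot wtAnd_rot
  card_filter_shift)

variable {n : ℕ}

/-! ## The even-`n` magic square: inputs, kernel vectors, laws -/

/-- certificate input `(i, j)` for even `n`: domino `i` on `{0,1,2}` (`i = 1 ↦ {1,2}`, `i = 2 ↦ {0,1}`), pattern `j` on
`{3,4,5}` (`j = 0 ↦ {5}`, `j = 1 ↦ {4}`, `j = 2 ↦ {3,4,5}`), zero elsewhere (an odd number of ones). -/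
def xE (n i j : ℕ) : Fin n → Bool := fun b =>
  decide ((i = 1 ∧ (b.val = 1 ∨ b.val = 2)) ∨ (i = 2 ∧ (b.val = 0 ∨ b.val = 1)) ∨
    (j = 0 ∧ (b.val = 5)) ∨ (j = 1 ∧ (b.val = 4)) ∨ (j = 2 ∧ (b.val = 3 ∨ b.val = 4 ∨ b.val = 5)))

/-- the explicit kernel vector of `xE n i j` (even `n`): a window table on `{0,…,5}` and, from position `6` on, an
alternating or full pattern (phase `(i + j) mod 3`). -/
def vE (n i j : ℕ) : Fin n → Bool := fun b =>
  decide (i = 0 ∧ j = 0 ∧ (b.val = 0 ∨ b.val = 2 ∨ b.val = 4 ∨ (6 ≤ b.val ∧ b.val % 2 = 0))) ||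
    decide (i = 0 ∧ j = 1 ∧ (b.val = 1 ∨ b.val = 3 ∨ b.val = 5 ∨ (6 ≤ b.val ∧ b.val % 2 = 1))) ||
    decide (i = 0 ∧ j = 2 ∧ (b.val = 0 ∨ b.val = 1 ∨ b.val = 2 ∨ b.val = 3 ∨ b.val = 5 ∨ 6 ≤ b.val)) ||
    decide (i = 1 ∧ j = 0 ∧ (b.val = 0 ∨ b.val = 1 ∨ b.val = 3 ∨ b.val = 5 ∨ 6 ≤ b.val)) ||
    decide (i = 1 ∧ j = 1 ∧ (b.val = 0 ∨ b.val = 2 ∨ b.val = 3 ∨ b.val = 4 ∨ (6 ≤ b.val ∧ b.val % 2 = 0))) ||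
    decide (i = 1 ∧ j = 2 ∧ (b.val = 1 ∨ b.val = 2 ∨ b.val = 4 ∨ b.val = 5 ∨ (6 ≤ b.val ∧ b.val % 2 = 1))) ||
    decide (i = 2 ∧ j = 0 ∧ (b.val = 1 ∨ b.val = 2 ∨ b.val = 3 ∨ b.val = 4 ∨ b.val = 5 ∨ (6 ≤ b.val ∧ b.val % 2 = 1))) ||
    decide (i = 2 ∧ j = 1 ∧ (b.val = 0 ∨ b.val = 2 ∨ b.val = 4 ∨ b.val = 5 ∨ 6 ≤ b.val)) ||
    decide (i = 2 ∧ j = 2 ∧ (b.val = 0 ∨ b.val = 1 ∨ b.val = 3 ∨ b.val = 4 ∨ (6 ≤ b.val ∧ b.val % 2 = 0)))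

/-- the sign table of the even-`n` square (cells whose kernel vector has an odd `edgesIn + wtAnd / 2`). -/
def sgE (i j : ℕ) : ZMod 2 := if (i = 0 ∧ j = 2) ∨ (i = 1 ∧ j = 0) ∨ (i = 1 ∧ j = 1) ∨ (i = 2 ∧ j = 0) ∨ (i = 2 ∧ j = 1) then 1 else 0

/-- `vE n i j` is a kernel vector of `xE n i j` (`n` even, `n ≥ 7`). -/
theorem inKernel_vE (hn : 7 ≤ n) (h2 : n % 2 = 0) {i j : ℕ} (hi : i < 3) (hj : j < 3) : InKernel (xE n i j) (vE n i j) := by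
  intro b
  rw [xor_xor_and_eq_false_iff]
  have hb := b.isLt
  interval_cases i <;> interval_cases j <;>
    simp only [xE, vE, Bool.or_eq_true, Bool.and_eq_true, decide_eq_true_eq, ne_eq, decide_eq_decide, prv_val, nxt_val, Nat.reduceEqDiff, mem_insert, mem_singleton, notMem_empty] <;>
    first | omega | (split_ifs <;> (try simp only [false_or, or_false, false_and, and_false, true_or, or_true, true_and, and_true, not_false_eq_true, not_true_eq_false, iff_true, iff_false, true_iff, false_iff, not_true, if_true, if_false]) <;> omega)

/-- every `xE n i j` lies in the odd class (`n` even, `n ≥ 7`). -/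
theorem oddZeros_xE (hn : 7 ≤ n) (h2 : n % 2 = 0) {i j : ℕ} (hi : i < 3) (hj : j < 3) : OddZeros (xE n i j) := by
  unfold OddZeros
  have key : ∀ (T : Finset ℕ) (c : ℕ), (∀ t ∈ T, t < 6) → T.card = c → c < 7 → (c + 1) % 2 = n % 2 →
      (∀ b : Fin n, xE n i j b = false ↔ b.val ∉ T) → (univ.filter fun b : Fin n => xE n i j b = false).card % 2 = 1 := by
    intro T c hT hc hc7 hpar h
    rw [card_filter_eq_sub_of_iff T (fun t ht => by have := hT t ht; omega) _ h, hc]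
    omega
  interval_cases i <;> interval_cases j
  · exact key {5} 1 (by simp) (by rfl) (by norm_num) (by omega) fun b => by
      have := b.isLt; simp only [xE, decide_eq_false_iff_not, decide_eq_true_eq, Nat.reduceEqDiff, mem_insert,
        mem_singleton, notMem_empty]; (try simp only [false_or, or_false, false_and, and_false, true_or, or_true, true_and, and_true, not_false_eq_true, not_true_eq_false, iff_true, iff_false, true_iff, false_iff, not_true, if_true, if_false]); all_goals omega
  · exact key {4} 1 (by simp) (by rfl) (by norm_num) (by omega) fun b => by
      have := b.isLt; simp only [xE, decide_eq_false_iff_not, decide_eq_true_eq, Nat.reduceEqDiff, mem_insert,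
        mem_singleton, notMem_empty]; (try simp only [false_or, or_false, false_and, and_false, true_or, or_true, true_and, and_true, not_false_eq_true, not_true_eq_false, iff_true, iff_false, true_iff, false_iff, not_true, if_true, if_false]); all_goals omega
  · exact key {3, 4, 5} 3 (by simp) (by rfl) (by norm_num) (by omega) fun b => by
      have := b.isLt; simp only [xE, decide_eq_false_iff_not, decide_eq_true_eq, Nat.reduceEqDiff, mem_insert,
        mem_singleton, notMem_empty]; (try simp only [false_or, or_false, false_and, and_false, true_or, or_true, true_and, and_true, not_false_eq_true, not_true_eq_false, iff_true, iff_false, true_iff, false_iff, not_true, if_true, if_false]); all_goals omega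
  · exact key {1, 2, 5} 3 (by simp) (by rfl) (by norm_num) (by omega) fun b => by
      have := b.isLt; simp only [xE, decide_eq_false_iff_not, decide_eq_true_eq, Nat.reduceEqDiff, mem_insert,
        mem_singleton, notMem_empty]; (try simp only [false_or, or_false, false_and, and_false, true_or, or_true, true_and, and_true, not_false_eq_true, not_true_eq_false, iff_true, iff_false, true_iff, false_iff, not_true, if_true, if_false]); all_goals omega
  · exact key {1, 2, 4} 3 (by simp) (by rfl) (by norm_num) (by omega) fun b => by
      have := b.isLt; simp only [xE, decide_eq_false_iff_not, decide_eq_true_eq, Nat.reduceEqDiff, mem_insert,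
        mem_singleton, notMem_empty]; (try simp only [false_or, or_false, false_and, and_false, true_or, or_true, true_and, and_true, not_false_eq_true, not_true_eq_false, iff_true, iff_false, true_iff, false_iff, not_true, if_true, if_false]); all_goals omega
  · exact key {1, 2, 3, 4, 5} 5 (by simp) (by rfl) (by norm_num) (by omega) fun b => by
      have := b.isLt; simp only [xE, decide_eq_false_iff_not, decide_eq_true_eq, Nat.reduceEqDiff, mem_insert,
        mem_singleton, notMem_empty]; (try simp only [false_or, or_false, false_and, and_false, true_or, or_true, true_and, and_true, not_false_eq_true, not_true_eq_false, iff_true, iff_false, true_iff, false_iff, not_true, if_true, if_false]); all_goals omega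
  · exact key {0, 1, 5} 3 (by simp) (by rfl) (by norm_num) (by omega) fun b => by
      have := b.isLt; simp only [xE, decide_eq_false_iff_not, decide_eq_true_eq, Nat.reduceEqDiff, mem_insert,
        mem_singleton, notMem_empty]; (try simp only [false_or, or_false, false_and, and_false, true_or, or_true, true_and, and_true, not_false_eq_true, not_true_eq_false, iff_true, iff_false, true_iff, false_iff, not_true, if_true, if_false]); all_goals omega
  · exact key {0, 1, 4} 3 (by simp) (by rfl) (by norm_num) (by omega) fun b => by
      have := b.isLt; simp only [xE, decide_eq_false_iff_not, decide_eq_true_eq, Nat.reduceEqDiff, mem_insert,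
        mem_singleton, notMem_empty]; (try simp only [false_or, or_false, false_and, and_false, true_or, or_true, true_and, and_true, not_false_eq_true, not_true_eq_false, iff_true, iff_false, true_iff, false_iff, not_true, if_true, if_false]); all_goals omega
  · exact key {0, 1, 3, 4, 5} 5 (by simp) (by rfl) (by norm_num) (by omega) fun b => by
      have := b.isLt; simp only [xE, decide_eq_false_iff_not, decide_eq_true_eq, Nat.reduceEqDiff, mem_insert,
        mem_singleton, notMem_empty]; (try simp only [false_or, or_false, false_and, and_false, true_or, or_true, true_and, and_true, not_false_eq_true, not_true_eq_false, iff_true, iff_false, true_iff, false_iff, not_true, if_true, if_false]); all_goals omega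

/-- the sign of cell `(i, j)`: `(edgesIn + wtAnd / 2) mod 2 = sgE i j` (`n` even, `n ≥ 7`). -/
theorem sign_vE (hn : 7 ≤ n) (h2 : n % 2 = 0) {i j : ℕ} (hi : i < 3) (hj : j < 3) :
    ((edgesIn (vE n i j) + wtAnd (xE n i j) (vE n i j) / 2 : ℕ) : ZMod 2) = sgE i j := by
  have hw : ∀ (T : Finset ℕ) (c : ℕ), (∀ t ∈ T, t < 6) → T.card = c →
      (∀ b : Fin n, (xE n i j b = true ∧ vE n i j b = true) ↔ b.val ∈ T) → wtAnd (xE n i j) (vE n i j) = c :=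
    fun T c hT hc h => (card_filter_eq_of_iff T (fun t ht => by have := hT t ht; omega) _ h).trans hc
  have he : ∀ (T : Finset ℕ) (c : ℕ), (∀ t ∈ T, t < 6) → T.card = c →
      (∀ b : Fin n, (vE n i j b = true ∧ vE n i j (nxt b) = true) ↔ b.val ∈ T) → edgesIn (vE n i j) = c :=
    fun T c hT hc h => (card_filter_eq_of_iff T (fun t ht => by have := hT t ht; omega) _ h).trans hc
  have hc : ∀ (T : Finset ℕ) (c : ℕ), (∀ t ∈ T, t < 6) → T.card = c →
      (∀ b : Fin n, (vE n i j b = true ∧ vE n i j (nxt b) = true) ↔ b.val ∉ T) → edgesIn (vE n i j) = n - c :=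
    fun T c hT hc h => (card_filter_eq_sub_of_iff T (fun t ht => by have := hT t ht; omega) _ h).trans (by rw [hc])
  have hodd : ∀ m : ℕ, m % 2 = 1 → ((m : ℕ) : ZMod 2) = 1 := fun m hm => ZMod.natCast_eq_one_iff_odd.2 (Nat.odd_iff.2 hm)
  have heven : ∀ m : ℕ, m % 2 = 0 → ((m : ℕ) : ZMod 2) = 0 := fun m hm => ZMod.natCast_eq_zero_iff_even.2 (Nat.even_iff.2 hm)
  interval_cases i <;> interval_cases j
  · rw [show sgE 0 0 = 0 from rfl, he ∅ 0 (by simp) (by rfl) (fun b => by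
        have := b.isLt; simp only [vE, Bool.or_eq_true, Bool.and_eq_true, decide_eq_true_eq, ne_eq, decide_eq_decide, prv_val, nxt_val, Nat.reduceEqDiff, mem_insert, mem_singleton, notMem_empty]; (try simp only [false_or, or_false, false_and, and_false, true_or, or_true, true_and, and_true, not_false_eq_true, not_true_eq_false, iff_true, iff_false, true_iff, false_iff, not_true, if_true, if_false]); all_goals first | omega | (split_ifs <;> (try simp only [false_or, or_false, false_and, and_false, true_or, or_true, true_and, and_true, not_false_eq_true, not_true_eq_false, iff_true, iff_false, true_iff, false_iff, not_true, if_true, if_false]) <;> omega)),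
      hw ∅ 0 (by simp) (by rfl) (fun b => by
        have := b.isLt; simp only [xE, vE, Bool.or_eq_true, Bool.and_eq_true, decide_eq_true_eq, ne_eq, decide_eq_decide, prv_val, nxt_val, Nat.reduceEqDiff, mem_insert, mem_singleton, notMem_empty]; (try simp only [false_or, or_false, false_and, and_false, true_or, or_true, true_and, and_true, not_false_eq_true, not_true_eq_false, iff_true, iff_false, true_iff, false_iff, not_true, if_true, if_false]); all_goals first | omega | (split_ifs <;> (try simp only [false_or, or_false, false_and, and_false, true_or, or_true, true_and, and_true, not_false_eq_true, not_true_eq_false, iff_true, iff_false, true_iff, false_iff, not_true, if_true, if_false]) <;> omega))]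
    exact heven _ (by omega)
  · rw [show sgE 0 1 = 0 from rfl, he ∅ 0 (by simp) (by rfl) (fun b => by
        have := b.isLt; simp only [vE, Bool.or_eq_true, Bool.and_eq_true, decide_eq_true_eq, ne_eq, decide_eq_decide, prv_val, nxt_val, Nat.reduceEqDiff, mem_insert, mem_singleton, notMem_empty]; (try simp only [false_or, or_false, false_and, and_false, true_or, or_true, true_and, and_true, not_false_eq_true, not_true_eq_false, iff_true, iff_false, true_iff, false_iff, not_true, if_true, if_false]); all_goals first | omega | (split_ifs <;> (try simp only [false_or, or_false, false_and, and_false, true_or, or_true, true_and, and_true, not_false_eq_true, not_true_eq_false, iff_true, iff_false, true_iff, false_iff, not_true, if_true, if_false]) <;> omega)),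
      hw ∅ 0 (by simp) (by rfl) (fun b => by
        have := b.isLt; simp only [xE, vE, Bool.or_eq_true, Bool.and_eq_true, decide_eq_true_eq, ne_eq, decide_eq_decide, prv_val, nxt_val, Nat.reduceEqDiff, mem_insert, mem_singleton, notMem_empty]; (try simp only [false_or, or_false, false_and, and_false, true_or, or_true, true_and, and_true, not_false_eq_true, not_true_eq_false, iff_true, iff_false, true_iff, false_iff, not_true, if_true, if_false]); all_goals first | omega | (split_ifs <;> (try simp only [false_or, or_false, false_and, and_false, true_or, or_true, true_and, and_true, not_false_eq_true, not_true_eq_false, iff_true, iff_false, true_iff, false_iff, not_true, if_true, if_false]) <;> omega))]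
    exact heven _ (by omega)
  · rw [show sgE 0 2 = 1 from rfl, hc {3, 4} 2 (by simp) (by rfl) (fun b => by
        have := b.isLt; simp only [vE, Bool.or_eq_true, Bool.and_eq_true, decide_eq_true_eq, ne_eq, decide_eq_decide, prv_val, nxt_val, Nat.reduceEqDiff, mem_insert, mem_singleton, notMem_empty]; (try simp only [false_or, or_false, false_and, and_false, true_or, or_true, true_and, and_true, not_false_eq_true, not_true_eq_false, iff_true, iff_false, true_iff, false_iff, not_true, if_true, if_false]); all_goals first | omega | (split_ifs <;> (try simp only [false_or, or_false, false_and, and_false, true_or, or_true, true_and, and_true, not_false_eq_true, not_true_eq_false, iff_true, iff_false, true_iff, false_iff, not_true, if_true, if_false]) <;> omega)),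
      hw {3, 5} 2 (by simp) (by rfl) (fun b => by
        have := b.isLt; simp only [xE, vE, Bool.or_eq_true, Bool.and_eq_true, decide_eq_true_eq, ne_eq, decide_eq_decide, prv_val, nxt_val, Nat.reduceEqDiff, mem_insert, mem_singleton, notMem_empty]; (try simp only [false_or, or_false, false_and, and_false, true_or, or_true, true_and, and_true, not_false_eq_true, not_true_eq_false, iff_true, iff_false, true_iff, false_iff, not_true, if_true, if_false]); all_goals first | omega | (split_ifs <;> (try simp only [false_or, or_false, false_and, and_false, true_or, or_true, true_and, and_true, not_false_eq_true, not_true_eq_false, iff_true, iff_false, true_iff, false_iff, not_true, if_true, if_false]) <;> omega))]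
    exact hodd _ (by omega)
  · rw [show sgE 1 0 = 1 from rfl, hc {1, 2, 3, 4} 4 (by simp) (by rfl) (fun b => by
        have := b.isLt; simp only [vE, Bool.or_eq_true, Bool.and_eq_true, decide_eq_true_eq, ne_eq, decide_eq_decide, prv_val, nxt_val, Nat.reduceEqDiff, mem_insert, mem_singleton, notMem_empty]; (try simp only [false_or, or_false, false_and, and_false, true_or, or_true, true_and, and_true, not_false_eq_true, not_true_eq_false, iff_true, iff_false, true_iff, false_iff, not_true, if_true, if_false]); all_goals first | omega | (split_ifs <;> (try simp only [false_or, or_false, false_and, and_false, true_or, or_true, true_and, and_true, not_false_eq_true, not_true_eq_false, iff_true, iff_false, true_iff, false_iff, not_true, if_true, if_false]) <;> omega)),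
      hw {1, 5} 2 (by simp) (by rfl) (fun b => by
        have := b.isLt; simp only [xE, vE, Bool.or_eq_true, Bool.and_eq_true, decide_eq_true_eq, ne_eq, decide_eq_decide, prv_val, nxt_val, Nat.reduceEqDiff, mem_insert, mem_singleton, notMem_empty]; (try simp only [false_or, or_false, false_and, and_false, true_or, or_true, true_and, and_true, not_false_eq_true, not_true_eq_false, iff_true, iff_false, true_iff, false_iff, not_true, if_true, if_false]); all_goals first | omega | (split_ifs <;> (try simp only [false_or, or_false, false_and, and_false, true_or, or_true, true_and, and_true, not_false_eq_true, not_true_eq_false, iff_true, iff_false, true_iff, false_iff, not_true, if_true, if_false]) <;> omega))]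
    exact hodd _ (by omega)
  · rw [show sgE 1 1 = 1 from rfl, he {2, 3} 2 (by simp) (by rfl) (fun b => by
        have := b.isLt; simp only [vE, Bool.or_eq_true, Bool.and_eq_true, decide_eq_true_eq, ne_eq, decide_eq_decide, prv_val, nxt_val, Nat.reduceEqDiff, mem_insert, mem_singleton, notMem_empty]; (try simp only [false_or, or_false, false_and, and_false, true_or, or_true, true_and, and_true, not_false_eq_true, not_true_eq_false, iff_true, iff_false, true_iff, false_iff, not_true, if_true, if_false]); all_goals first | omega | (split_ifs <;> (try simp only [false_or, or_false, false_and, and_false, true_or, or_true, true_and, and_true, not_false_eq_true, not_true_eq_false, iff_true, iff_false, true_iff, false_iff, not_true, if_true, if_false]) <;> omega)),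
      hw {2, 4} 2 (by simp) (by rfl) (fun b => by
        have := b.isLt; simp only [xE, vE, Bool.or_eq_true, Bool.and_eq_true, decide_eq_true_eq, ne_eq, decide_eq_decide, prv_val, nxt_val, Nat.reduceEqDiff, mem_insert, mem_singleton, notMem_empty]; (try simp only [false_or, or_false, false_and, and_false, true_or, or_true, true_and, and_true, not_false_eq_true, not_true_eq_false, iff_true, iff_false, true_iff, false_iff, not_true, if_true, if_false]); all_goals first | omega | (split_ifs <;> (try simp only [false_or, or_false, false_and, and_false, true_or, or_true, true_and, and_true, not_false_eq_true, not_true_eq_false, iff_true, iff_false, true_iff, false_iff, not_true, if_true, if_false]) <;> omega))]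
    exact hodd _ (by omega)
  · rw [show sgE 1 2 = 0 from rfl, he {1, 4} 2 (by simp) (by rfl) (fun b => by
        have := b.isLt; simp only [vE, Bool.or_eq_true, Bool.and_eq_true, decide_eq_true_eq, ne_eq, decide_eq_decide, prv_val, nxt_val, Nat.reduceEqDiff, mem_insert, mem_singleton, notMem_empty]; (try simp only [false_or, or_false, false_and, and_false, true_or, or_true, true_and, and_true, not_false_eq_true, not_true_eq_false, iff_true, iff_false, true_iff, false_iff, not_true, if_true, if_false]); all_goals first | omega | (split_ifs <;> (try simp only [false_or, or_false, false_and, and_false, true_or, or_true, true_and, and_true, not_false_eq_true, not_true_eq_false, iff_true, iff_false, true_iff, false_iff, not_true, if_true, if_false]) <;> omega)),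
      hw {1, 2, 4, 5} 4 (by simp) (by rfl) (fun b => by
        have := b.isLt; simp only [xE, vE, Bool.or_eq_true, Bool.and_eq_true, decide_eq_true_eq, ne_eq, decide_eq_decide, prv_val, nxt_val, Nat.reduceEqDiff, mem_insert, mem_singleton, notMem_empty]; (try simp only [false_or, or_false, false_and, and_false, true_or, or_true, true_and, and_true, not_false_eq_true, not_true_eq_false, iff_true, iff_false, true_iff, false_iff, not_true, if_true, if_false]); all_goals first | omega | (split_ifs <;> (try simp only [false_or, or_false, false_and, and_false, true_or, or_true, true_and, and_true, not_false_eq_true, not_true_eq_false, iff_true, iff_false, true_iff, false_iff, not_true, if_true, if_false]) <;> omega))]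
    exact heven _ (by omega)
  · rw [show sgE 2 0 = 1 from rfl, he {1, 2, 3, 4} 4 (by simp) (by rfl) (fun b => by
        have := b.isLt; simp only [vE, Bool.or_eq_true, Bool.and_eq_true, decide_eq_true_eq, ne_eq, decide_eq_decide, prv_val, nxt_val, Nat.reduceEqDiff, mem_insert, mem_singleton, notMem_empty]; (try simp only [false_or, or_false, false_and, and_false, true_or, or_true, true_and, and_true, not_false_eq_true, not_true_eq_false, iff_true, iff_false, true_iff, false_iff, not_true, if_true, if_false]); all_goals first | omega | (split_ifs <;> (try simp only [false_or, or_false, false_and, and_false, true_or, or_true, true_and, and_true, not_false_eq_true, not_true_eq_false, iff_true, iff_false, true_iff, false_iff, not_true, if_true, if_false]) <;> omega)),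
      hw {1, 5} 2 (by simp) (by rfl) (fun b => by
        have := b.isLt; simp only [xE, vE, Bool.or_eq_true, Bool.and_eq_true, decide_eq_true_eq, ne_eq, decide_eq_decide, prv_val, nxt_val, Nat.reduceEqDiff, mem_insert, mem_singleton, notMem_empty]; (try simp only [false_or, or_false, false_and, and_false, true_or, or_true, true_and, and_true, not_false_eq_true, not_true_eq_false, iff_true, iff_false, true_iff, false_iff, not_true, if_true, if_false]); all_goals first | omega | (split_ifs <;> (try simp only [false_or, or_false, false_and, and_false, true_or, or_true, true_and, and_true, not_false_eq_true, not_true_eq_false, iff_true, iff_false, true_iff, false_iff, not_true, if_true, if_false]) <;> omega))]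
    exact hodd _ (by omega)
  · rw [show sgE 2 1 = 1 from rfl, hc {0, 1, 2, 3} 4 (by simp) (by rfl) (fun b => by
        have := b.isLt; simp only [vE, Bool.or_eq_true, Bool.and_eq_true, decide_eq_true_eq, ne_eq, decide_eq_decide, prv_val, nxt_val, Nat.reduceEqDiff, mem_insert, mem_singleton, notMem_empty]; (try simp only [false_or, or_false, false_and, and_false, true_or, or_true, true_and, and_true, not_false_eq_true, not_true_eq_false, iff_true, iff_false, true_iff, false_iff, not_true, if_true, if_false]); all_goals first | omega | (split_ifs <;> (try simp only [false_or, or_false, false_and, and_false, true_or, or_true, true_and, and_true, not_false_eq_true, not_true_eq_false, iff_true, iff_false, true_iff, false_iff, not_true, if_true, if_false]) <;> omega)),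
      hw {0, 4} 2 (by simp) (by rfl) (fun b => by
        have := b.isLt; simp only [xE, vE, Bool.or_eq_true, Bool.and_eq_true, decide_eq_true_eq, ne_eq, decide_eq_decide, prv_val, nxt_val, Nat.reduceEqDiff, mem_insert, mem_singleton, notMem_empty]; (try simp only [false_or, or_false, false_and, and_false, true_or, or_true, true_and, and_true, not_false_eq_true, not_true_eq_false, iff_true, iff_false, true_iff, false_iff, not_true, if_true, if_false]); all_goals first | omega | (split_ifs <;> (try simp only [false_or, or_false, false_and, and_false, true_or, or_true, true_and, and_true, not_false_eq_true, not_true_eq_false, iff_true, iff_false, true_iff, false_iff, not_true, if_true, if_false]) <;> omega))]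
    exact hodd _ (by omega)
  · rw [show sgE 2 2 = 0 from rfl, he {0, 3} 2 (by simp) (by rfl) (fun b => by
        have := b.isLt; simp only [vE, Bool.or_eq_true, Bool.and_eq_true, decide_eq_true_eq, ne_eq, decide_eq_decide, prv_val, nxt_val, Nat.reduceEqDiff, mem_insert, mem_singleton, notMem_empty]; (try simp only [false_or, or_false, false_and, and_false, true_or, or_true, true_and, and_true, not_false_eq_true, not_true_eq_false, iff_true, iff_false, true_iff, false_iff, not_true, if_true, if_false]); all_goals first | omega | (split_ifs <;> (try simp only [false_or, or_false, false_and, and_false, true_or, or_true, true_and, and_true, not_false_eq_true, not_true_eq_false, iff_true, iff_false, true_iff, false_iff, not_true, if_true, if_false]) <;> omega)),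
      hw {0, 1, 3, 4} 4 (by simp) (by rfl) (fun b => by
        have := b.isLt; simp only [xE, vE, Bool.or_eq_true, Bool.and_eq_true, decide_eq_true_eq, ne_eq, decide_eq_decide, prv_val, nxt_val, Nat.reduceEqDiff, mem_insert, mem_singleton, notMem_empty]; (try simp only [false_or, or_false, false_and, and_false, true_or, or_true, true_and, and_true, not_false_eq_true, not_true_eq_false, iff_true, iff_false, true_iff, false_iff, not_true, if_true, if_false]); all_goals first | omega | (split_ifs <;> (try simp only [false_or, or_false, false_and, and_false, true_or, or_true, true_and, and_true, not_false_eq_true, not_true_eq_false, iff_true, iff_false, true_iff, false_iff, not_true, if_true, if_false]) <;> omega))]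
    exact heven _ (by omega)

/-- COLUMN LAW (even `n`): at every position `b ≥ 3` the three kernel vectors of column `j` have even sum. -/
theorem colE {j : ℕ} (hj : j < 3) (b : Fin n) (hb : 3 ≤ b.val) :
    (xor (xor (vE n 0 j b) (vE n 1 j b)) (vE n 2 j b)) = false := by
  have hlt := b.isLt
  rw [xor3_false_iff]
  interval_cases j <;> simp only [vE, Bool.or_eq_true, Bool.and_eq_true, decide_eq_true_eq, ne_eq, decide_eq_decide, prv_val, nxt_val, Nat.reduceEqDiff, mem_insert, mem_singleton, notMem_empty] <;> (try simp only [false_or, or_false, false_and, and_false, true_or, or_true, true_and, and_true, not_false_eq_true, not_true_eq_false, iff_true, iff_false, true_iff, false_iff, not_true, if_true, if_false]) <;> omega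

/-- ROW LAW (even `n`): at every position `b ∉ {3,4,5}` the three kernel vectors of row `i` have even sum. -/
theorem rowE {i : ℕ} (hi : i < 3) (b : Fin n) (hb : b.val < 3 ∨ 6 ≤ b.val) :
    (xor (xor (vE n i 0 b) (vE n i 1 b)) (vE n i 2 b)) = false := by
  have hlt := b.isLt
  rw [xor3_false_iff]
  interval_cases i <;> simp only [vE, Bool.or_eq_true, Bool.and_eq_true, decide_eq_true_eq, ne_eq, decide_eq_decide, prv_val, nxt_val, Nat.reduceEqDiff, mem_insert, mem_singleton, notMem_empty] <;> (try simp only [false_or, or_false, false_and, and_false, true_or, or_true, true_and, and_true, not_false_eq_true, not_true_eq_false, iff_true, iff_false, true_iff, false_iff, not_true, if_true, if_false]) <;> omega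

/-- the column-`j` inputs agree at positions `≥ 3`: the `i`-domino lives on `{0,1,2}`. -/
theorem xE_agree_on (i j : ℕ) (b : Fin n) (hb : 3 ≤ b.val) : xE n i j b = xE n 0 j b := by
  simp only [xE]; rw [decide_eq_decide]; omega

/-- the row-`i` inputs agree at positions `< 3` or `≥ 6`: the `j`-pattern lives on `{3,4,5}`. -/
theorem xE_agree_off (i j : ℕ) (b : Fin n) (hb : b.val < 3 ∨ 6 ≤ b.val) : xE n i j b = xE n i 0 b := by
  simp only [xE]; rw [decide_eq_decide]; omega

/-- SIGN LAW (even `n`): the nine signs sum to `1`. -/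
theorem sgE_sum : (∑ i : Fin 3, ∑ j : Fin 3, sgE i j) = 1 := by
  simp only [Fin.sum_univ_three, Fin.val_zero, Fin.val_one, Fin.val_two]; decide

/-- ★ THE EVEN MAGIC SQUARE: for even `n ≥ 7`, a strategy map that is bipartite-local for a bipartition facing `3|3` in
the frame rotated by `m` loses the ring game on one of the nine rotated odd-class inputs `rot m (xE n i j)`. -/
theorem magicE_at (hn : 7 ≤ n) (h2 : n % 2 = 0) (m : ℕ) {S : Finset (Fin n)} (hS : Faces33At m S)
    {z : (Fin n → Bool) → Fin n → Bool} (hz : BiLocal S z) :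
    ∃ i j : ℕ, i < 3 ∧ j < 3 ∧ OddZeros (rot m (xE n i j)) ∧ ¬ Rel (rot m (xE n i j)) (z (rot m (xE n i j))) := by
  obtain ⟨i, j, hi, hj, h⟩ := magic_of_square hz (fun i j => rot m (xE n i j)) (fun i j => rot m (vE n i j)) sgE
    (fun i j hi hj => (inKernel_rot m _ _).2 (inKernel_vE hn h2 hi hj))
    (fun i j hi hj => by simp only [edgesIn_rot, wtAnd_rot]; exact sign_vE hn h2 hi hj) sgE_sum
    (fun j hj b hb => by simp only [rot_apply]; exact colE hj _ (hS.three_le hb))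
    (fun i hi b hb => by simp only [rot_apply]; exact rowE hi _ (hS.off hb))
    (fun i j b hb => by simp only [rot_apply]; exact xE_agree_on i j _ (hS.three_le hb))
    (fun i j b hb => by simp only [rot_apply]; exact xE_agree_off i j _ (hS.off hb))
  exact ⟨i, j, hi, hj, (oddZeros_rot m _).2 (oddZeros_xE hn h2 hi hj), h⟩


/-! ## Every cut, every length: the bipartite-local class loses from `n = 7` on -/

/-- ★★ CUT-LOCAL STRATEGIES LOSE (degree-free, `n ≥ 7`): a strategy map that is bipartite-local for a bipartition of the
ring positions facing `3|3` at some window (sharp there, arbitrary elsewhere) loses the ring game on an odd-class input. -/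
theorem cutLocal_loses (hn : 7 ≤ n) (m : ℕ) {S : Finset (Fin n)} (hS : Faces33At m S)
    {z : (Fin n → Bool) → Fin n → Bool} (hz : BiLocal S z) : ∃ x : Fin n → Bool, OddZeros x ∧ ¬ Rel x (z x) := by
  rcases Nat.mod_two_eq_zero_or_one n with h2 | h2
  · obtain ⟨i, j, -, -, ho, h⟩ := magicE_at hn h2 m hS hz; exact ⟨_, ho, h⟩
  · obtain ⟨i, j, -, -, ho, h⟩ := magicO_at hn h2 m hS hz; exact ⟨_, ho, h⟩

/-! ### Arc cuts: a strategy map that factorises across an arc and its complement loses -/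

/-- the ARC of positions `a, a+1, …, a+L-1`. -/
def arcSet (n a L : ℕ) : Finset (Fin n) := univ.filter fun b : Fin n => a ≤ b.val ∧ b.val < a + L

/-- the rotated frame that puts the arc `[a, a+L)` at positions `3, 4, …`: shifting by `n - (a - 3)`. -/
theorem shift_val_arcFrame (a : ℕ) (b : Fin n) :
    (shift n (n - (a - 3)) b).val = if a - 3 ≤ b.val then b.val - (a - 3) else b.val + (n - (a - 3)) := by
  have hb := b.isLt
  show (b.val + (n - (a - 3))) % n = _
  split_ifs with h
  · rw [show b.val + (n - (a - 3)) = (b.val - (a - 3)) + n by omega, Nat.add_mod_right, Nat.mod_eq_of_lt (by omega)]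
  · exact Nat.mod_eq_of_lt (by omega)

/-- an arc of length `≥ 3` starting at `a ≥ 3` and ending before `n` faces `3|3` in the frame shifted by `n - (a - 3)`. -/
theorem faces33At_arc {a L : ℕ} (ha : 3 ≤ a) (hL : 3 ≤ L) (haL : a + L ≤ n) :
    Faces33At (n - (a - 3)) (arcSet n a L) := by
  intro b
  have hb := b.isLt
  simp only [arcSet, mem_filter, mem_univ, true_and, not_and, not_lt, shift_val_arcFrame a b]
  constructor
  · intro h3 hab; split_ifs at h3 <;> omega
  · intro h3 h6; split_ifs at h3 h6 <;> omega

/-- ★ ARC-FACTORISED STRATEGIES LOSE (`n ≥ 7`, degree-free): if the outputs on an arc of length `≥ 3` (starting at a position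
`≥ 3`, at least nothing else is asked of the cut) read only the inputs on the arc, and the outputs off the arc only the inputs
off the arc, the strategy map loses the ring game on an odd-class input.  By rotation invariance of the game
(`RingSymmetry.rel_rot`) the position of the arc is immaterial; the normalisation `3 ≤ a` only fixes the frame. -/
theorem arcLocal_loses (hn : 7 ≤ n) {a L : ℕ} (ha : 3 ≤ a) (hL : 3 ≤ L) (haL : a + L ≤ n)
    {z : (Fin n → Bool) → Fin n → Bool} (hz : BiLocal (arcSet n a L) z) : ∃ x : Fin n → Bool, OddZeros x ∧ ¬ Rel x (z x) :=
  cutLocal_loses hn (n - (a - 3)) (faces33At_arc ha hL haL) hz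

/-! ### Partition-local and point-local strategies are cut-local

A strategy map that is local with respect to ANY partition of the ring into blocks (each output reads only the inputs of its own
block) is bi-local across every union of blocks; so as soon as the partition separates the two triples of some window it loses.
In particular POINT-LOCAL maps (each output reads only its own input bit — the "one player per vertex" strategies of graph games)
lose the ring game for every `n ≥ 7`, odd or even. -/

/-- the strategy map `z` is LOCAL WITH RESPECT TO THE BLOCK ASSIGNMENT `β`: output `b` reads only inputs `c` with `β c = β b`. -/
def BlockLocal {ι : Type*} (β : Fin n → ι) (z : (Fin n → Bool) → Fin n → Bool) : Prop :=
  ∀ x y : Fin n → Bool, ∀ b : Fin n, (∀ c, β c = β b → x c = y c) → z x b = z y b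

/-- block-local across `β` ⇒ bi-local across every `S` that is a union of blocks of `β`. -/
theorem biLocal_of_blockLocal {ι : Type*} {β : Fin n → ι} {S : Finset (Fin n)} {z : (Fin n → Bool) → Fin n → Bool}
    (hS : ∀ b c, β b = β c → (b ∈ S ↔ c ∈ S)) (hz : BlockLocal β z) : BiLocal S z := by
  refine ⟨fun x y hxy b hb => hz x y b fun c hc => hxy c ((hS c b hc).2 hb), fun x y hxy b hb => hz x y b fun c hc => ?_⟩
  exact hxy c fun hcS => hb ((hS c b hc).1 hcS)

/-- ★ PARTITION-LOCAL STRATEGIES LOSE (`n ≥ 7`): if the blocks of `β` can be collected into a set `S` facing `3|3` in some frame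
(i.e. no block meets both triples of that window), every `β`-local strategy map loses on an odd-class input. -/
theorem blockLocal_loses (hn : 7 ≤ n) {ι : Type*} {β : Fin n → ι} (m : ℕ) {S : Finset (Fin n)} (hS : Faces33At m S)
    (hSβ : ∀ b c, β b = β c → (b ∈ S ↔ c ∈ S)) {z : (Fin n → Bool) → Fin n → Bool} (hz : BlockLocal β z) :
    ∃ x : Fin n → Bool, OddZeros x ∧ ¬ Rel x (z x) :=
  cutLocal_loses hn m hS (biLocal_of_blockLocal hSβ hz)

/-- the strategy map is POINT-LOCAL: output `b` reads only the input bit at `b`. -/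
def PointLocal (z : (Fin n → Bool) → Fin n → Bool) : Prop :=
  ∀ x y : Fin n → Bool, ∀ b : Fin n, x b = y b → z x b = z y b

/-- ★ POINT-LOCAL STRATEGIES LOSE for every `n ≥ 7` (odd AND even `n`): the ring-HLF analogue, for two-sided cuts, of the
vertex-per-player impossibility in graph games. -/
theorem pointLocal_loses (hn : 7 ≤ n) {z : (Fin n → Bool) → Fin n → Bool} (hz : PointLocal z) :
    ∃ x : Fin n → Bool, OddZeros x ∧ ¬ Rel x (z x) := by
  refine cutLocal_loses hn 0 (S := univ.filter fun b : Fin n => 3 ≤ (shift n 0 b).val) (fun b => ?_)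
    ⟨fun x y hxy b hb => hz x y b (hxy b hb), fun x y hxy b hb => hz x y b (hxy b hb)⟩
  simp only [mem_filter, mem_univ, true_and, not_le]
  exact ⟨fun h => h, fun h _ => h⟩

end Summit.QuantumAdvantage.QuantumAdvantage.Theorems.CutDial
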